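import Summits.CriticalPhenomena.PercolationContinuityZ3.Theorems.Transplant.SkelPhiCorridorKGYRegions
import HarnessLib

/-!
# N2 (frames-only node `SamePDropOfSkeletonFrm₁`, OPEN), (R) column, reading rows — **EVERY REGION OF THE SECOND-AXIS K-G CORRIDOR LIES IN A
# DRIFT-PAIRED BOX** `Skelφ.kgCorrSchedY_region_paired`: region `r` ⊆ `[k·v − B⁻, k·v + B⁺] × [k·sLo − Q⁻, k·sHi + Q⁺]` for some `k ≤ N + 1`
# (`k := r` on the run, `k := N + 1` on both parking phases), with UNIFORM widths `B∓`, `Q∓` ((R-50): the root's y′-corridor is read per region;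
# the reading de-shears `k·v` against `k·sLo` — `KS.pairing_bounds`)

From p5's `kgCorrSchedY_region_run_box / _park₁_box / _park₂_box` (SkelPhiCorridorKGYRegions) and `dS = sHi − sLo`.  Rows-generic (any
`n ℓ h v R′ ρ q W N m₁ Wm₂ Wp₂ m₂` with the schedule's structural hypotheses, plus `Wm₂ + Wp₂ ≤ E`).
NON-VACUITY (lead g11 standing order): box containment, nothing assumed beyond the schedule's own hypotheses.
builds on p205010 (kernel theorem, internal audit signed; external expert review pending) — nothing in this file uses p205010; NOTHING is claimed
about the open node `SamePDropOfSkeletonFrm₁`.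
Lane `prim-bschramm`, seat `prim-bschramm-p3` (gen 18; N2 design owner, (R) column owner); helper file (`--supports stmt-CriticalPhenomena-4575 --as helper`).
[cite: KozmaNitzan2024, §4 Lemma 11 (p. 22), Lemma 12 (pp. 23–25)]
-/

noncomputable section

open scoped Classical

namespace Summit.CriticalPhenomena.PercolationContinuityZ3.Theorems.Transplant

namespace Skelφ

open Literature.Probability.Percolation Literature.Probability.LatticeModels SimpleGraph
open ChainPlanar ChainPara

section Paired

variable {n ℓ : ℕ} {h v : ℤ} {R' ρ q W N m₁ Wm₂ Wp₂ m₂ : ℕ} (hn : 1 ≤ n) (hv : |v| ≤ n) (hlay : (n + h.natAbs : ℕ) ≤ (n : ℤ) * ℓ + 1)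
  (hP₁ : ParkOK (kgPark₁Y n ℓ h v R' ρ q W N m₁)) (hP₂ : ParkOK (kgPark₂Y n ℓ h v R' ρ q W N m₁ Wm₂ Wp₂ m₂))
  (hsplit : (Wm₂ : ℤ) + Wp₂ = (kgPark₁Y n ℓ h v R' ρ q W N m₁).aHi (m₁ + 1) - ParkPrm.aLo (kgPark₁Y n ℓ h v R' ρ q W N m₁) (m₁ + 1))

/-- `(dS : ℤ) ≤ sHi − sLo` with `sLo = ⌊(nℓ − U + 1)/U⌋`, `sHi = ⌊nℓ/U⌋ + 1`. [folklore] -/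
theorem dS_le_sHi_sub_sLo (hn : 1 ≤ n) (ℓ : ℕ) (h : ℤ) :
    ((dS n ℓ h : ℕ) : ℤ) ≤ ((n : ℤ) * ℓ / (shearUnit n h : ℕ) + 1) - ((n : ℤ) * ℓ - (shearUnit n h : ℕ) + 1) / (shearUnit n h : ℕ) := by
  have hU : (0 : ℤ) < (shearUnit n h : ℕ) := shearUnit_pos hn h
  have hU' : 0 < shearUnit n h := by exact_mod_cast hU
  have e1 : ((n : ℤ) * ℓ - (shearUnit n h : ℕ) + 1) / (shearUnit n h : ℕ) = ((n : ℤ) * ℓ + 1) / (shearUnit n h : ℕ) + (-1) := by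
    rw [← Int.add_mul_ediv_right _ _ (ne_of_gt hU)]; congr 1; ring
  have e2 : (((n * ℓ + 1) / shearUnit n h : ℕ) : ℤ) = ((n : ℤ) * ℓ + 1) / (shearUnit n h : ℕ) := by push_cast; rfl
  have e3 : (((n * ℓ) / shearUnit n h : ℕ) : ℤ) = ((n : ℤ) * ℓ) / (shearUnit n h : ℕ) := by push_cast; rfl
  have hle : (n * ℓ + 1) / shearUnit n h ≤ n * ℓ / shearUnit n h + 2 := by
    have h1 : (n * ℓ + 1) / shearUnit n h ≤ (n * ℓ + shearUnit n h) / shearUnit n h := Nat.div_le_div_right (by omega)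
    rw [Nat.add_div_right _ hU'] at h1; omega
  unfold dS
  rw [Nat.cast_sub hle]
  push_cast
  rw [e1]
  have : (((n * ℓ + 1) / shearUnit n h : ℕ) : ℤ) = ((n : ℤ) * ℓ + 1) / (shearUnit n h : ℕ) := e2
  linarith [this, e3]

include hn hv hlay hP₁ hP₂ hsplit in
/-- **EVERY REGION IN A DRIFT-PAIRED BOX** (see the module docstring): `k := r` for the run regions `r ≤ N`, `k := N + 1` for the parking regions;
`E` is any bound on `Wm₂ + Wp₂` (at the rows of record: `kgE₁Y`). [cite: KozmaNitzan2024, §4 Lemma 12 (pp. 23–25)] -/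
theorem kgCorrSchedY_region_paired {E : ℤ} (hE : (Wm₂ : ℤ) + Wp₂ ≤ E) {r : ℕ} (hr : r ≤ (kgCorrSchedY hn hv hlay hP₁ hP₂ hsplit).N)
    {y : Site 2} (hy : y ∈ (kgCorrSchedY hn hv hlay hP₁ hP₂ hsplit).region r) :
    ∃ k : ℕ, k ≤ N + 1 ∧
      (k : ℤ) * v - (((kgA₁Ym n v R' W N : ℕ) : ℤ) + 2 * n + R' + E + (m₂ : ℤ) * (R' + ρ + |v|)) ≤ y 0 ∧
      y 0 ≤ (k : ℤ) * v + (((kgA₁Yp n v R' W N : ℕ) : ℤ) + ((m₁ : ℤ) + 1) * (R' + ρ) + (m₂ : ℤ) * (R' + ρ + |v|) + R' + n) ∧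
      (k : ℤ) * (((n : ℤ) * ℓ - (shearUnit n h : ℕ) + 1) / (shearUnit n h : ℕ)) - ((q : ℤ) + ((N : ℤ) + 1) * R' + ((m₁ : ℤ) + 1) * (R' + ρ) + ((n : ℤ) * ℓ / (shearUnit n h : ℕ) + 1) + R' + ((3 * (n * ℓ) / shearUnit n h + 1 : ℕ) : ℤ)) ≤ y 1 ∧
      y 1 ≤ (k : ℤ) * ((n : ℤ) * ℓ / (shearUnit n h : ℕ) + 1) + ((q : ℤ) + ((N : ℤ) + 1) * R' + ((m₁ : ℤ) + 1) * (R' + ρ) + (m₂ : ℤ) * (R' + ρ) + R' + ((3 * (n * ℓ) / shearUnit n h + 1 : ℕ) : ℤ)) := by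
  have hSN := (kgCorrSchedY_params hn hv hlay hP₁ hP₂ hsplit).1
  have hR0 : (0 : ℤ) ≤ R' := by positivity
  have hρ0 : (0 : ℤ) ≤ ρ := by positivity
  have hn0 : (0 : ℤ) ≤ n := by positivity
  have hva : 0 ≤ |v| := abs_nonneg v
  have hm₁0 : (0 : ℤ) ≤ m₁ := by positivity
  have hm₂0 : (0 : ℤ) ≤ m₂ := by positivity
  have hAm : (0 : ℤ) ≤ ((kgA₁Ym n v R' W N : ℕ) : ℤ) := by positivity
  have hAp : (0 : ℤ) ≤ ((kgA₁Yp n v R' W N : ℕ) : ℤ) := by positivity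
  have hE0 : (0 : ℤ) ≤ E := le_trans (by positivity) hE
  have hL0 : (0 : ℤ) ≤ ((3 * (n * ℓ) / shearUnit n h + 1 : ℕ) : ℤ) := by positivity
  have hU : (0 : ℤ) < (shearUnit n h : ℕ) := shearUnit_pos hn h
  have hP0 : (0 : ℤ) ≤ ((n : ℤ) * ℓ / (shearUnit n h : ℕ) + 1) := by
    have : (0 : ℤ) ≤ (n : ℤ) * ℓ / (shearUnit n h : ℕ) := Int.ediv_nonneg (by positivity) hU.le
    linarith
  have hdS := dS_le_sHi_sub_sLo hn ℓ h
  have hAm_eq : ((kgA₁Ym n v R' W N : ℕ) : ℤ) = ((((n : ℤ) + v).toNat + W : ℕ) : ℤ) + ((N : ℤ) + 1) * R' := by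
    unfold kgA₁Ym; push_cast; ring
  have hAp_eq : ((kgA₁Yp n v R' W N : ℕ) : ℤ) = ((((n : ℤ) - v).toNat + W : ℕ) : ℤ) + ((N : ℤ) + 1) * R' := by
    unfold kgA₁Yp; push_cast; ring
  have eN : (((N + 1 : ℕ)) : ℤ) = (N : ℤ) + 1 := by push_cast; ring
  have hNd : ((N : ℤ) + 1) * ((dS n ℓ h : ℕ) : ℤ) + ((N : ℤ) + 1) * (((n : ℤ) * ℓ - (shearUnit n h : ℕ) + 1) / (shearUnit n h : ℕ)) ≤ ((N : ℤ) + 1) * ((n : ℤ) * ℓ / (shearUnit n h : ℕ) + 1) := by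
    have h1 := mul_le_mul_of_nonneg_left hdS (show (0 : ℤ) ≤ (N : ℤ) + 1 by positivity)
    have e : ((N : ℤ) + 1) * (((n : ℤ) * ℓ / (shearUnit n h : ℕ) + 1) - (((n : ℤ) * ℓ - (shearUnit n h : ℕ) + 1) / (shearUnit n h : ℕ))) = ((N : ℤ) + 1) * ((n : ℤ) * ℓ / (shearUnit n h : ℕ) + 1) - ((N : ℤ) + 1) * (((n : ℤ) * ℓ - (shearUnit n h : ℕ) + 1) / (shearUnit n h : ℕ)) := mul_sub _ _ _
    linarith
  have hm1 : (0 : ℤ) ≤ ((m₁ : ℤ) + 1) * (R' + ρ) := by positivity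
  have hm2 : (0 : ℤ) ≤ (m₂ : ℤ) * (R' + ρ) := by positivity
  have hmm : (0 : ℤ) ≤ (m₂ : ℤ) * (R' + ρ + |v|) := by positivity
  by_cases hkN : r ≤ N
  · -- run region: k := r
    obtain ⟨h1, h2, h3, h4⟩ := kgCorrSchedY_region_run_box hn hv hlay hP₁ hP₂ hsplit hkN hy
    have hk1 : ((r : ℤ) + 1) * R' ≤ ((N : ℤ) + 1) * R' := mul_le_mul_of_nonneg_right (by exact_mod_cast Nat.succ_le_succ hkN) hR0
    refine ⟨r, by omega, ?_, ?_, ?_, ?_⟩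
    · rw [hAm_eq]; linarith
    · rw [hAp_eq]; linarith
    · linarith
    · linarith
  · by_cases hk1 : r ≤ N + 1 + m₁
    · -- first parking phase: k := N + 1
      obtain ⟨j, rfl⟩ : ∃ j, r = N + 1 + j := ⟨r - (N + 1), by omega⟩
      have hj : j ≤ m₁ := by omega
      obtain ⟨h1, h2, h3, h4⟩ := kgCorrSchedY_region_park₁_box hn hv hlay hP₁ hP₂ hsplit hj hy
      have hjm : (j : ℤ) * (R' + ρ) ≤ ((m₁ : ℤ) + 1) * (R' + ρ) :=
        mul_le_mul_of_nonneg_right (by exact_mod_cast Nat.le_succ_of_le hj) (by positivity)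
      have hj0 : (0 : ℤ) ≤ (j : ℤ) * (R' + ρ) := by positivity
      refine ⟨N + 1, le_rfl, ?_, ?_, ?_, ?_⟩ <;> rw [eN]
      · linarith
      · linarith
      · linarith
      · linarith
    · -- second parking phase: k := N + 1
      obtain ⟨j, rfl⟩ : ∃ j, r = N + 1 + m₁ + 1 + j := ⟨r - (N + 1 + m₁ + 1), by omega⟩
      have hj : j ≤ m₂ := by rw [hSN] at hr; omega
      obtain ⟨h1, h2, h3, h4⟩ := kgCorrSchedY_region_park₂_box hn hv hlay hP₁ hP₂ hsplit j hy
      rw [kgC₂Y_zero] at h3 h4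
      have haHi : (kgPark₁Y n ℓ h v R' ρ q W N m₁).aHi (m₁ + 1) = ((kgA₁Yp n v R' W N : ℕ) : ℤ) + (((m₁ + 1 : ℕ)) : ℤ) * ((R' : ℤ) + (ρ : ℤ)) := rfl
      have em : (((m₁ + 1 : ℕ)) : ℤ) = (m₁ : ℤ) + 1 := by push_cast; ring
      rw [em] at haHi
      rw [haHi] at h3 h4
      have hjm : (j : ℤ) * (R' + ρ + |v|) ≤ (m₂ : ℤ) * (R' + ρ + |v|) := mul_le_mul_of_nonneg_right (by exact_mod_cast hj) (by positivity)
      have hjm' : (j : ℤ) * (R' + ρ) ≤ (m₂ : ℤ) * (R' + ρ) := mul_le_mul_of_nonneg_right (by exact_mod_cast hj) (by positivity)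
      have hj0 : (0 : ℤ) ≤ (j : ℤ) * (R' + ρ + |v|) := by positivity
      have hWm : (0 : ℤ) ≤ (Wm₂ : ℤ) := by positivity
      have hWp : (0 : ℤ) ≤ (Wp₂ : ℤ) := by positivity
      refine ⟨N + 1, le_rfl, ?_, ?_, ?_, ?_⟩ <;> rw [eN]
      · linarith
      · linarith
      · linarith
      · linarith

end Paired

end Skelφ

end Summit.CriticalPhenomena.PercolationContinuityZ3.Theorems.Transplant

end
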